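import Summits.QuantumFields.YangMills.Theorems.BalabanUVNodesN19ClassSandwichAtRecord
import Summits.QuantumFields.YangMills.Theorems.BalabanUVNodesN14ConvexFibreCauchy

/-!
# BalabanUVNodes ∕ N19 → N14 — THE U3 FACE FOR N14 AT THE RECORD's KEYS, SUPPORT-TOLERANT (TV) EDITION: TV_cl of the NORMALISED class laws of slots pushed to the unit
# lattice ⇒ N14's binder `TiltedMeanMatching … (K ↦ 4·e^{2l₀}·ρ K)` with `Summable`, and the joint MASS_cl ∧ TV_cl face (module 26 v1.1's `Core` ∧ N14's binder)

Cell `pub-ymgap` (HUMAN RULING D-0062 Track A; director-ym №197 ∕ HUMAN RULING D-0149 width push), WIDTH SEAT `pub-ymgap-dag-n19-w2` (g0), plan g77 `W-SEAT-START-LIST.md`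
v3 §2 n19 ITEM 2 (w2) = dag-n19-d g22's (3′) «§N19 s1's U3 face for N14».  Sibling of this seat's `…N19ShapeFaceN14AtRecord` (the SHAPE-density edition); filed `--kind proof
--supports stmt-QuantumFields-20544 --as helper` (K3⁷).  COUNT-NEUTRAL.  THEOREMS ONLY (0 `def`); imports dag-n19-d's module 26 `…N19ClassSandwichAtRecord` (p500938 ∕ v1.1
p505620: `prodObs_eq_prodW_comp_A`, `abs_prodW_le_one`, `measurable_prodW`, v1.1 §5 `core_classWeightOfDatum₉_of_mass_of_tv`; through it n19-c's `…N19CoreTVInvariant` p504410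
`tiltedMeanMatching_of_tv` and MODULE B `…N19MGFFormAtRecord`) and n14-c's `…N14ConvexFibreCauchy` (`tiltedMean_map`) ONLY; every cited lemma BY NAME; edits nothing.

WHY A TV EDITION (n19-c g8 `…N19CoreTVInvariant`).  SHAPE_cl in density form — the sibling's `hSh` — forces, class by class, MUTUAL ABSOLUTE CONTINUITY of the two runs'
pushed-forward class laws with a bounded log-density, in particular EQUAL SUPPORTS on the unit lattice; two runs whose class pieces are cut by different small-field
characteristic functions need not satisfy it.  n19-c proved the observable-uniform `Spine.NE7.Core` EQUIVALENT to MASS_cl ∧ TV_cl (SHAPE strictly more: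
`N19TVCurrency.tv_not_shape_toy`) and TV_cl ALONE ⇒ the (I)-binder (`tiltedMeanMatching_of_tv`, width `4B·e^{2l₀B}·ρ_K`, classes massless in one run included).  So the U3
read-out sentence for N14 is offered in BOTH currencies: `hSh` (what a density-producing expansion hands; sibling) and `hTV` (what `Core` needs; here).
* §1 [folklore, GENERIC two keys] `tiltedMeanMatching_of_tv_map₂` · `exists_tiltedMeanMatching_summable_of_tv_map₂`.
* §2 at general key LEVELS of ONE scheme: `tiltedMeanMatching_of_tv_atKeys`.
* §3 ★ AT THE RECORD's KEYS (module 26 v1.1 `core_classWeightOfDatum₉_of_mass_of_tv`'s binder prefix VERBATIM, `hM` dropped): `tiltedMeanMatching_classMeasureOfSlots_of_tv` ·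
  `exists_tiltedMeanMatching_summable_classMeasureOfSlots_of_tv` · ★ `core_and_tiltedMeanMatching_classWeightOfDatum₉_of_mass_of_tv` (ONE displayed pair MASS_cl ∧ TV_cl — the
  necessary-and-sufficient observable-uniform invariant — serves N19's `Core` AND N14's binder at the record).

THE U3 READ-OUT SENTENCE, TV CURRENCY (displayed hypothesis `hTV`): for every `K`, every source `|t| ≤ l₀`, every class `τ` good at `t` and every measurable set `S` of unit-lattice
fields, the NORMALISED masses of `S` under run B's and run A's class measures of slots pushed forward by `A_{(pB K).K}` ∕ `A_{(pA K).K}` differ by at most `ρ K` (a massless class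
reads `0`).

HONEST FRAMING.  ZERO ESTIMATE CONTENT: `hTV` (and `hM`) are HYPOTHESIS SHAPES — UNPRINTED two-run statements for d = 4, produced by nobody; order arithmetic on measures and
integrals + by-name compositions; nothing of Bałaban's instantiated or asserted; NE7 ∕ NE1′ NOT PRINTED as two-run statements and NOT PROVED; N14 ∕ N19 NOT discharged (N19 0∕1);
K3⁷ OPEN, NOT claimed; counts UNMOVED (typed 28∕28 · discharged 5∕27, A 5∕28); one finite four-torus programme at fixed `ε = L^{−K}`, Bałaban AS PRINTED — NOT ℝ⁴, NOT infinite
volume, NOT OS, NOT a mass gap, NOT Clay: R4 closes the conditional finite-𝕋⁴ rung `BalabanLadder.UV` only.  0 `def`; 0 `sorry`; standard axioms; no decl below carries a cite tag.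
-/

set_option autoImplicit false

noncomputable section

open MeasureTheory ProbabilityTheory
open scoped ENNReal Matrix.Norms.L2Operator

namespace Summit.QuantumFields.YangMills.BalabanUVNodes.N19ShapeFaceN14AtRecordTV

open Summit.QuantumFields.BalabanUV.T4Continuum.NE1p.DressedMGFForm (tiltedMean MGFForm TiltedMeanMatching)
open Summit.QuantumFields.BalabanUV.T4Continuum.Spine.NE7 (Core)
open Summit.QuantumFields.YangMills.BalabanUVNodes.N19ClassSandwichRoad
open Summit.QuantumFields.YangMills.BalabanUVNodes.N19ClassSandwichAtRecord
open YMDAG.N14.ConvexFibreCauchy (tiltedMean_map)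
open Literature.MathematicalPhysics.QuantumFieldTheory.Balaban1983to89

/-! ## §1 GENERIC, TWO KEYS: TV_cl of the normalised pushed-forward class laws ⇒ N14's binder on the runs' own spaces -/

section TwoKeysTV

variable {X : Type*} [MeasurableSpace X] {ΩA ΩB : ℕ → Type*} [∀ K, MeasurableSpace (ΩA K)] [∀ K, MeasurableSpace (ΩB K)]
  {ι : Type*} [DecidableEq ι] {l₀ B : ℝ} {T : ℕ → Finset ι} {Bad : ℕ → ℝ → Finset ι} {φ : X → ℝ}
  {a : ∀ K, ΩA K → X} {b : ∀ K, ΩB K → X}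
  {νA : ∀ K, ι → Measure (ΩA K)} {νB : ∀ K, ι → Measure (ΩB K)} {ρ : ℕ → ℝ}

/-- **THE U3 FACE FOR N14 IN THE TV CURRENCY, TWO KEYS** [folklore]: finite class measures of BOTH runs on their own spaces, ONE bounded measurable unit-lattice observable `φ`,
and TV_cl (`hTV`, spelled out): on every class good at an admissible source the NORMALISED pushed-forward class laws are `ρ K`-close on every measurable set of `X` (massless
classes read `0 − 0`) ⇒ `TiltedMeanMatching l₀ T Bad (φ ∘ a ·) νA (φ ∘ b ·) νB (K ↦ 4B·e^{2l₀B}·ρ K)` (n19-c's `tiltedMeanMatching_of_tv` on `X` + n14-c's `tiltedMean_map`). [folklore] -/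
theorem tiltedMeanMatching_of_tv_map₂ (ha : ∀ K, Measurable (a K)) (hb : ∀ K, Measurable (b K)) (hφ : Measurable φ) (hφb : ∀ u, |φ u| ≤ B) (hB : 0 ≤ B)
    (hfinA : ∀ K, ∀ τ ∈ T K, IsFiniteMeasure (νA K τ)) (hfinB : ∀ K, ∀ τ ∈ T K, IsFiniteMeasure (νB K τ))
    (hTV : ∀ (K : ℕ) (t : ℝ), |t| ≤ l₀ → ∀ τ ∈ T K \ Bad K t, ∀ S : Set X, MeasurableSet S →
      |((νB K τ).map (b K)).real S / ((νB K τ).map (b K)).real Set.univ - ((νA K τ).map (a K)).real S / ((νA K τ).map (a K)).real Set.univ| ≤ ρ K) :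
    TiltedMeanMatching l₀ T Bad (fun K => φ ∘ a K) νA (fun K => φ ∘ b K) νB fun K => 4 * B * Real.exp (2 * (l₀ * B)) * ρ K := by
  have h := N19CoreTVInvariant.tiltedMeanMatching_of_tv (Ω := fun _ => X) (T := T) (Bad := Bad) (l₀ := l₀) (ρ := ρ)
    (μA := fun K τ => (νA K τ).map (a K)) (μB := fun K τ => (νB K τ).map (b K)) (W := fun _ => φ)
    (fun K τ hτ => by haveI := hfinA K τ hτ; exact Measure.isFiniteMeasure_map (νA K τ) (a K))
    (fun K τ hτ => by haveI := hfinB K τ hτ; exact Measure.isFiniteMeasure_map (νB K τ) (b K)) hB (fun _ => hφ) (fun _ x => hφb x) hTV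
  intro K t ht τ hτ s hs
  have hK := h K t ht τ hτ s hs
  rw [tiltedMean_map (hb K) hφ, tiltedMean_map (ha K) hφ] at hK
  exact hK

/-- **… WITH A SUMMABLE MAJORANT** [folklore]: `Σ ρ K < ∞` ⇒ `∃ η, TiltedMeanMatching … η ∧ Summable η`. [folklore] -/
theorem exists_tiltedMeanMatching_summable_of_tv_map₂ (ha : ∀ K, Measurable (a K)) (hb : ∀ K, Measurable (b K)) (hφ : Measurable φ) (hφb : ∀ u, |φ u| ≤ B)
    (hB : 0 ≤ B) (hfinA : ∀ K, ∀ τ ∈ T K, IsFiniteMeasure (νA K τ)) (hfinB : ∀ K, ∀ τ ∈ T K, IsFiniteMeasure (νB K τ))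
    (hTV : ∀ (K : ℕ) (t : ℝ), |t| ≤ l₀ → ∀ τ ∈ T K \ Bad K t, ∀ S : Set X, MeasurableSet S →
      |((νB K τ).map (b K)).real S / ((νB K τ).map (b K)).real Set.univ - ((νA K τ).map (a K)).real S / ((νA K τ).map (a K)).real Set.univ| ≤ ρ K)
    (hρs : Summable ρ) :
    ∃ η : ℕ → ℝ, TiltedMeanMatching l₀ T Bad (fun K => φ ∘ a K) νA (fun K => φ ∘ b K) νB η ∧ Summable η :=
  ⟨_, tiltedMeanMatching_of_tv_map₂ ha hb hφ hφb hB hfinA hfinB hTV, hρs.mul_left _⟩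

end TwoKeysTV

/-! ## §2 At general key LEVELS of ONE scheme with a unit factorisation -/

section AtKeysTV

variable {G O : Type*} {S : Missing.TorusScheme G O} [MeasurableSpace G] {X : Type*} [MeasurableSpace X]
  {ι : Type*} [DecidableEq ι] {l₀ : ℝ} {T : ℕ → Finset ι} {Bad : ℕ → ℝ → Finset ι}
  {kA kB : ℕ → ℕ} {νA : ∀ K, ι → Measure (GaugeField (S.P (kA K)) 0 G)} {νB : ∀ K, ι → Measure (GaugeField (S.P (kB K)) 0 G)} {ρ : ℕ → ℝ}

/-- **THE TV FACE AT GENERAL KEY LEVELS** [folklore]: `prodObs S k os = prodW ∘ A k` (`|prodW| ≤ 1`), finite class measures of both runs, TV_cl of the class laws pushed to the unit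
lattice by `N.A (kA K)` ∕ `N.A (kB K)` ⇒ `TiltedMeanMatching … (K ↦ 4·e^{2l₀}·ρ K)`. [folklore] -/
theorem tiltedMeanMatching_of_tv_atKeys (N : T4VarianceMatching.UnitFactorisation S X) (os : List O)
    (hfinA : ∀ K, ∀ τ ∈ T K, IsFiniteMeasure (νA K τ)) (hfinB : ∀ K, ∀ τ ∈ T K, IsFiniteMeasure (νB K τ))
    (hTV : ∀ (K : ℕ) (t : ℝ), |t| ≤ l₀ → ∀ τ ∈ T K \ Bad K t, ∀ S : Set X, MeasurableSet S →
      |((νB K τ).map (N.A (kB K))).real S / ((νB K τ).map (N.A (kB K))).real Set.univ -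
          ((νA K τ).map (N.A (kA K))).real S / ((νA K τ).map (N.A (kA K))).real Set.univ| ≤ ρ K) :
    TiltedMeanMatching l₀ T Bad (fun K => T4GenFunBounds.prodObs S (kA K) os) νA (fun K => T4GenFunBounds.prodObs S (kB K) os) νB
      fun K => 4 * Real.exp (2 * l₀) * ρ K := by
  have hA : (fun K => T4GenFunBounds.prodObs S (kA K) os) = fun K => (fun u => (os.map fun o => N.W o u).prod) ∘ N.A (kA K) :=
    funext fun K => prodObs_eq_prodW_comp_A N (kA K) os
  have hB : (fun K => T4GenFunBounds.prodObs S (kB K) os) = fun K => (fun u => (os.map fun o => N.W o u).prod) ∘ N.A (kB K) :=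
    funext fun K => prodObs_eq_prodW_comp_A N (kB K) os
  rw [hA, hB]
  have h := tiltedMeanMatching_of_tv_map₂ (ΩA := fun K => GaugeField (S.P (kA K)) 0 G) (ΩB := fun K => GaugeField (S.P (kB K)) 0 G)
    (a := fun K => N.A (kA K)) (b := fun K => N.A (kB K)) (T := T) (Bad := Bad) (l₀ := l₀) (νA := νA) (νB := νB) (ρ := ρ)
    (fun K => N.measurable_A (kA K)) (fun K => N.measurable_A (kB K))
    (measurable_prodW N os) (abs_prodW_le_one N os) zero_le_one hfinA hfinB hTV
  intro K t ht τ hτ s hs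
  have hK := h K t ht τ hτ s hs
  simp only [mul_one] at hK ⊢
  exact hK

end AtKeysTV

/-! ## §3 ★ AT THE RECORD's KEYS: the knit with MODULE B and module 26 v1.1 §5 -/

section AtRecordTV

open Literature.MathematicalPhysics.QuantumFieldTheory.Balaban1983to89.Node00
open T4Continuum B14.Eq218Concrete
open Summit.QuantumFields.YangMills.BalabanUVNodes.N19MGFKernelTower (classMeasureOfSlots)
open Summit.QuantumFields.YangMills.BalabanUVNodes.N19MGFFormAtRecord (mgfForm_classWeightOfDatum₉_of_ppSelId)

variable {F : T4Family} {N : ℕ} [NeZero N] {ι : Type*} [DecidableEq ι] {l₀ vol : ℝ} {Bad : ℕ → ℝ → Finset ι} {r₁ ρ δ : ℕ → ℝ}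

/-- **★★ THE U3 FACE FOR N14 AT THE RECORD's KEYS, TV CURRENCY** [bookkeeping] — module 26 v1.1's `core_classWeightOfDatum₉_of_mass_of_tv` with `hM` dropped and `Core` ↦
`TiltedMeanMatching`: two runs of the record keyed by `pA pB`, MODULE B's laws at the identity selector, the canonical `T4RunLadder.unitFactorisation D hD g₀`, and TV_cl(`ρ`) of the
NORMALISED class laws of slots pushed to `GaugeField (F.P 0) 0 (SU N)` on measurable sets ⇒ `TiltedMeanMatching … (K ↦ 4·e^{2l₀}·ρ K)` for MODULE B's observables ∕ class measures —
support-tolerant (class pieces massless or differently supported in one run allowed).  ZERO estimate content: `hTV` is the residual. [folklore] -/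
theorem tiltedMeanMatching_classMeasureOfSlots_of_tv (ϑ : Stage9Params F N) (hsel : ϑ.ppSel = ppSelIdOfRecord F ϑ.ν ϑ.τ9.M)
    (hw0 : ∀ p g k s' U V', 0 ≤ wOfRecord₉ F N ϑ p g k s' U V') (hw1 : ∀ p g k s' U V', wOfRecord₉ F N ϑ p g k s' U V' ≤ 1)
    (hwm : ∀ (p : B12.RunParams) (g : ℕ → ℝ) k s',
      Measurable fun z : GaugeField (F.P p.K) (k + 1) (SU N) × GaugeField (F.P p.K) k (SU N) => wOfRecord₉ F N ϑ p g k s' z.2 z.1)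
    (hχm : ∀ (p : B12.RunParams) (g : ℕ → ℝ) k s, Measurable (chiSeqOfRecord F N ϑ.ν ϑ.τ9.M g p.K k s))
    (D : FiniteEpsData F (SU N)) (hD : D.AvgMeasurable) (g₀ : ℕ → ℝ) (os : List (ULoop F))
    (pA pB : ℕ → B12.RunParams) (gA gB : ℕ → ℕ → ℝ) (kA kB : ℕ → ℕ) (T : ℕ → Finset ι)
    (eA : ∀ K, ι → SeqOfRecord F ϑ.ν ϑ.τ9.M (gA K) (pA K).K (kA K)) (eB : ∀ K, ι → SeqOfRecord F ϑ.ν ϑ.τ9.M (gB K) (pB K).K (kB K))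
    (hTV : ∀ (K : ℕ) (t : ℝ), |t| ≤ l₀ → ∀ τ ∈ T K \ Bad K t, ∀ S : Set (GaugeField (F.P 0) 0 (SU N)), MeasurableSet S →
      |((classMeasureOfSlots F N ϑ.ν ϑ.τ9 (wOfRecord₉ F N ϑ) (pB K) (gB K) (Missing.boltzmann (F.P (pB K).K) ((g₀ (pB K).K)⁻¹ ^ 2))
            (kB K) (eB K τ)).map ((T4RunLadder.unitFactorisation D hD g₀).A (pB K).K)).real S /
          ((classMeasureOfSlots F N ϑ.ν ϑ.τ9 (wOfRecord₉ F N ϑ) (pB K) (gB K) (Missing.boltzmann (F.P (pB K).K) ((g₀ (pB K).K)⁻¹ ^ 2))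
            (kB K) (eB K τ)).map ((T4RunLadder.unitFactorisation D hD g₀).A (pB K).K)).real Set.univ -
        ((classMeasureOfSlots F N ϑ.ν ϑ.τ9 (wOfRecord₉ F N ϑ) (pA K) (gA K) (Missing.boltzmann (F.P (pA K).K) ((g₀ (pA K).K)⁻¹ ^ 2))
            (kA K) (eA K τ)).map ((T4RunLadder.unitFactorisation D hD g₀).A (pA K).K)).real S /
          ((classMeasureOfSlots F N ϑ.ν ϑ.τ9 (wOfRecord₉ F N ϑ) (pA K) (gA K) (Missing.boltzmann (F.P (pA K).K) ((g₀ (pA K).K)⁻¹ ^ 2))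
            (kA K) (eA K τ)).map ((T4RunLadder.unitFactorisation D hD g₀).A (pA K).K)).real Set.univ| ≤ ρ K) :
    TiltedMeanMatching l₀ T Bad (fun K => T4GenFunBounds.prodObs (D.scheme g₀) (pA K).K os)
      (fun K τ => classMeasureOfSlots F N ϑ.ν ϑ.τ9 (wOfRecord₉ F N ϑ) (pA K) (gA K) (Missing.boltzmann (F.P (pA K).K) ((g₀ (pA K).K)⁻¹ ^ 2))
        (kA K) (eA K τ))
      (fun K => T4GenFunBounds.prodObs (D.scheme g₀) (pB K).K os)
      (fun K τ => classMeasureOfSlots F N ϑ.ν ϑ.τ9 (wOfRecord₉ F N ϑ) (pB K) (gB K) (Missing.boltzmann (F.P (pB K).K) ((g₀ (pB K).K)⁻¹ ^ 2))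
        (kB K) (eB K τ))
      fun K => 4 * Real.exp (2 * l₀) * ρ K :=
  tiltedMeanMatching_of_tv_atKeys (T4RunLadder.unitFactorisation D hD g₀) os
    (mgfForm_classWeightOfDatum₉_of_ppSelId ϑ hsel hw0 hw1 hwm hχm D hD g₀ os pA gA kA T eA).finite
    (mgfForm_classWeightOfDatum₉_of_ppSelId ϑ hsel hw0 hw1 hwm hχm D hD g₀ os pB gB kB T eB).finite hTV

/-- **★★ THE (I)-SLOT PAIR AT THE RECORD, TV CURRENCY** [bookkeeping]: `Σ ρ K < ∞` ⇒ `∃ η, TiltedMeanMatching … η ∧ Summable η` for MODULE B's observables and class measures of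
slots. [folklore] -/
theorem exists_tiltedMeanMatching_summable_classMeasureOfSlots_of_tv (ϑ : Stage9Params F N) (hsel : ϑ.ppSel = ppSelIdOfRecord F ϑ.ν ϑ.τ9.M)
    (hw0 : ∀ p g k s' U V', 0 ≤ wOfRecord₉ F N ϑ p g k s' U V') (hw1 : ∀ p g k s' U V', wOfRecord₉ F N ϑ p g k s' U V' ≤ 1)
    (hwm : ∀ (p : B12.RunParams) (g : ℕ → ℝ) k s',
      Measurable fun z : GaugeField (F.P p.K) (k + 1) (SU N) × GaugeField (F.P p.K) k (SU N) => wOfRecord₉ F N ϑ p g k s' z.2 z.1)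
    (hχm : ∀ (p : B12.RunParams) (g : ℕ → ℝ) k s, Measurable (chiSeqOfRecord F N ϑ.ν ϑ.τ9.M g p.K k s))
    (D : FiniteEpsData F (SU N)) (hD : D.AvgMeasurable) (g₀ : ℕ → ℝ) (os : List (ULoop F))
    (pA pB : ℕ → B12.RunParams) (gA gB : ℕ → ℕ → ℝ) (kA kB : ℕ → ℕ) (T : ℕ → Finset ι)
    (eA : ∀ K, ι → SeqOfRecord F ϑ.ν ϑ.τ9.M (gA K) (pA K).K (kA K)) (eB : ∀ K, ι → SeqOfRecord F ϑ.ν ϑ.τ9.M (gB K) (pB K).K (kB K))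
    (hTV : ∀ (K : ℕ) (t : ℝ), |t| ≤ l₀ → ∀ τ ∈ T K \ Bad K t, ∀ S : Set (GaugeField (F.P 0) 0 (SU N)), MeasurableSet S →
      |((classMeasureOfSlots F N ϑ.ν ϑ.τ9 (wOfRecord₉ F N ϑ) (pB K) (gB K) (Missing.boltzmann (F.P (pB K).K) ((g₀ (pB K).K)⁻¹ ^ 2))
            (kB K) (eB K τ)).map ((T4RunLadder.unitFactorisation D hD g₀).A (pB K).K)).real S /
          ((classMeasureOfSlots F N ϑ.ν ϑ.τ9 (wOfRecord₉ F N ϑ) (pB K) (gB K) (Missing.boltzmann (F.P (pB K).K) ((g₀ (pB K).K)⁻¹ ^ 2))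
            (kB K) (eB K τ)).map ((T4RunLadder.unitFactorisation D hD g₀).A (pB K).K)).real Set.univ -
        ((classMeasureOfSlots F N ϑ.ν ϑ.τ9 (wOfRecord₉ F N ϑ) (pA K) (gA K) (Missing.boltzmann (F.P (pA K).K) ((g₀ (pA K).K)⁻¹ ^ 2))
            (kA K) (eA K τ)).map ((T4RunLadder.unitFactorisation D hD g₀).A (pA K).K)).real S /
          ((classMeasureOfSlots F N ϑ.ν ϑ.τ9 (wOfRecord₉ F N ϑ) (pA K) (gA K) (Missing.boltzmann (F.P (pA K).K) ((g₀ (pA K).K)⁻¹ ^ 2))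
            (kA K) (eA K τ)).map ((T4RunLadder.unitFactorisation D hD g₀).A (pA K).K)).real Set.univ| ≤ ρ K)
    (hρs : Summable ρ) :
    ∃ η : ℕ → ℝ, TiltedMeanMatching l₀ T Bad (fun K => T4GenFunBounds.prodObs (D.scheme g₀) (pA K).K os)
      (fun K τ => classMeasureOfSlots F N ϑ.ν ϑ.τ9 (wOfRecord₉ F N ϑ) (pA K) (gA K) (Missing.boltzmann (F.P (pA K).K) ((g₀ (pA K).K)⁻¹ ^ 2))
        (kA K) (eA K τ))
      (fun K => T4GenFunBounds.prodObs (D.scheme g₀) (pB K).K os)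
      (fun K τ => classMeasureOfSlots F N ϑ.ν ϑ.τ9 (wOfRecord₉ F N ϑ) (pB K) (gB K) (Missing.boltzmann (F.P (pB K).K) ((g₀ (pB K).K)⁻¹ ^ 2))
        (kB K) (eB K τ)) η ∧ Summable η :=
  ⟨_, tiltedMeanMatching_classMeasureOfSlots_of_tv ϑ hsel hw0 hw1 hwm hχm D hD g₀ os pA pB gA gB kA kB T eA eB hTV, hρs.mul_left _⟩

/-- **★ THE JOINT FACE AT THE RECORD IN THE NECESSARY-AND-SUFFICIENT CURRENCY** [bookkeeping]: MASS_cl(`r₁`) ∧ TV_cl(`ρ`) of the two pushed-forward class laws of slots with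
`r₁ K + (e^{2l₀} − 1)·ρ K ≤ vol·δ K` ⇒ module 26 v1.1's dressed `Spine.NE7.Core` for `classWeightOfDatum₉` (`core_classWeightOfDatum₉_of_mass_of_tv`, BY NAME) AND N14's binder with
`η K = 4·e^{2l₀}·ρ K` — ONE displayed U3 sentence pair (the observable-uniform invariant of n19-c p504410) serves N19 and N14 at the record. [folklore] -/
theorem core_and_tiltedMeanMatching_classWeightOfDatum₉_of_mass_of_tv (ϑ : Stage9Params F N) (hsel : ϑ.ppSel = ppSelIdOfRecord F ϑ.ν ϑ.τ9.M)
    (hw0 : ∀ p g k s' U V', 0 ≤ wOfRecord₉ F N ϑ p g k s' U V') (hw1 : ∀ p g k s' U V', wOfRecord₉ F N ϑ p g k s' U V' ≤ 1)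
    (hwm : ∀ (p : B12.RunParams) (g : ℕ → ℝ) k s',
      Measurable fun z : GaugeField (F.P p.K) (k + 1) (SU N) × GaugeField (F.P p.K) k (SU N) => wOfRecord₉ F N ϑ p g k s' z.2 z.1)
    (hχm : ∀ (p : B12.RunParams) (g : ℕ → ℝ) k s, Measurable (chiSeqOfRecord F N ϑ.ν ϑ.τ9.M g p.K k s))
    (D : FiniteEpsData F (SU N)) (hD : D.AvgMeasurable) (g₀ : ℕ → ℝ) (os : List (ULoop F))
    (pA pB : ℕ → B12.RunParams) (gA gB : ℕ → ℕ → ℝ) (kA kB : ℕ → ℕ) (T : ℕ → Finset ι)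
    (eA : ∀ K, ι → SeqOfRecord F ϑ.ν ϑ.τ9.M (gA K) (pA K).K (kA K)) (eB : ∀ K, ι → SeqOfRecord F ϑ.ν ϑ.τ9.M (gB K) (pB K).K (kB K))
    (hM : ∀ K : ℕ, ∃ c : ℝ, ∀ t : ℝ, |t| ≤ l₀ → ∀ τ ∈ T K \ Bad K t,
      ENNReal.ofReal (Real.exp (c - r₁ K)) *
          ((classMeasureOfSlots F N ϑ.ν ϑ.τ9 (wOfRecord₉ F N ϑ) (pA K) (gA K) (Missing.boltzmann (F.P (pA K).K) ((g₀ (pA K).K)⁻¹ ^ 2))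
            (kA K) (eA K τ)).map ((T4RunLadder.unitFactorisation D hD g₀).A (pA K).K)) Set.univ ≤
        ((classMeasureOfSlots F N ϑ.ν ϑ.τ9 (wOfRecord₉ F N ϑ) (pB K) (gB K) (Missing.boltzmann (F.P (pB K).K) ((g₀ (pB K).K)⁻¹ ^ 2))
            (kB K) (eB K τ)).map ((T4RunLadder.unitFactorisation D hD g₀).A (pB K).K)) Set.univ ∧
      ((classMeasureOfSlots F N ϑ.ν ϑ.τ9 (wOfRecord₉ F N ϑ) (pB K) (gB K) (Missing.boltzmann (F.P (pB K).K) ((g₀ (pB K).K)⁻¹ ^ 2))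
            (kB K) (eB K τ)).map ((T4RunLadder.unitFactorisation D hD g₀).A (pB K).K)) Set.univ ≤
        ENNReal.ofReal (Real.exp (c + r₁ K)) *
          ((classMeasureOfSlots F N ϑ.ν ϑ.τ9 (wOfRecord₉ F N ϑ) (pA K) (gA K) (Missing.boltzmann (F.P (pA K).K) ((g₀ (pA K).K)⁻¹ ^ 2))
            (kA K) (eA K τ)).map ((T4RunLadder.unitFactorisation D hD g₀).A (pA K).K)) Set.univ)
    (hTV : ∀ (K : ℕ) (t : ℝ), |t| ≤ l₀ → ∀ τ ∈ T K \ Bad K t, ∀ S : Set (GaugeField (F.P 0) 0 (SU N)), MeasurableSet S →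
      |((classMeasureOfSlots F N ϑ.ν ϑ.τ9 (wOfRecord₉ F N ϑ) (pB K) (gB K) (Missing.boltzmann (F.P (pB K).K) ((g₀ (pB K).K)⁻¹ ^ 2))
            (kB K) (eB K τ)).map ((T4RunLadder.unitFactorisation D hD g₀).A (pB K).K)).real S /
          ((classMeasureOfSlots F N ϑ.ν ϑ.τ9 (wOfRecord₉ F N ϑ) (pB K) (gB K) (Missing.boltzmann (F.P (pB K).K) ((g₀ (pB K).K)⁻¹ ^ 2))
            (kB K) (eB K τ)).map ((T4RunLadder.unitFactorisation D hD g₀).A (pB K).K)).real Set.univ -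
        ((classMeasureOfSlots F N ϑ.ν ϑ.τ9 (wOfRecord₉ F N ϑ) (pA K) (gA K) (Missing.boltzmann (F.P (pA K).K) ((g₀ (pA K).K)⁻¹ ^ 2))
            (kA K) (eA K τ)).map ((T4RunLadder.unitFactorisation D hD g₀).A (pA K).K)).real S /
          ((classMeasureOfSlots F N ϑ.ν ϑ.τ9 (wOfRecord₉ F N ϑ) (pA K) (gA K) (Missing.boltzmann (F.P (pA K).K) ((g₀ (pA K).K)⁻¹ ^ 2))
            (kA K) (eA K τ)).map ((T4RunLadder.unitFactorisation D hD g₀).A (pA K).K)).real Set.univ| ≤ ρ K)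
    (hw : ∀ K, r₁ K + (Real.exp (2 * (l₀ * 1)) - 1) * ρ K ≤ vol * δ K) :
    Core l₀ vol T Bad (fun K t τ => classWeightOfDatum₉ F N ϑ D g₀ os (pA K) (gA K) (kA K) t (eA K τ))
        (fun K t τ => classWeightOfDatum₉ F N ϑ D g₀ os (pB K) (gB K) (kB K) t (eB K τ)) δ ∧
      TiltedMeanMatching l₀ T Bad (fun K => T4GenFunBounds.prodObs (D.scheme g₀) (pA K).K os)
        (fun K τ => classMeasureOfSlots F N ϑ.ν ϑ.τ9 (wOfRecord₉ F N ϑ) (pA K) (gA K) (Missing.boltzmann (F.P (pA K).K) ((g₀ (pA K).K)⁻¹ ^ 2))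
          (kA K) (eA K τ))
        (fun K => T4GenFunBounds.prodObs (D.scheme g₀) (pB K).K os)
        (fun K τ => classMeasureOfSlots F N ϑ.ν ϑ.τ9 (wOfRecord₉ F N ϑ) (pB K) (gB K) (Missing.boltzmann (F.P (pB K).K) ((g₀ (pB K).K)⁻¹ ^ 2))
          (kB K) (eB K τ))
        fun K => 4 * Real.exp (2 * l₀) * ρ K :=
  ⟨core_classWeightOfDatum₉_of_mass_of_tv ϑ hsel hw0 hw1 hwm hχm D hD g₀ os pA pB gA gB kA kB T eA eB hM hTV hw,
    tiltedMeanMatching_classMeasureOfSlots_of_tv ϑ hsel hw0 hw1 hwm hχm D hD g₀ os pA pB gA gB kA kB T eA eB hTV⟩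

end AtRecordTV

end Summit.QuantumFields.YangMills.BalabanUVNodes.N19ShapeFaceN14AtRecordTV

end
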